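import Summits.Ventures.QEC.Census.CertBZPlaneSeg2
import Summits.Ventures.QEC.Census.BB.A1s_n186_k10_42ba7993.Cert
import HarnessLib

/-!
# `A1s_n186_k10_42ba7993` — side Z lane FAMILIES, packed module 14/42 (qec-search-10 g4 packfam.py: parts BZPlaneFamZ0m1p11;
# — split piece `BZPlaneFamZP13` (1/3 of `BZPlaneFamZP13`, qec-search-10 g5 splitfam.py: Σ lanes 12157823, 3 theorems; the one-level `segOK` parts run ≈ 4× slower per lane at the gate) at tier KERNEL — type-01 lane engine δ (`Plane.segOK` / `Plane.seg2OK`, Census/CertBZPlaneSeg2.lean);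
# assembled by the block files `BZPlaneBlkZP*.lean`. First part's header:
# # `A1s_n186_k10_42ba7993` — certificate `28a8c3e9cd9695fa…`, side Z, block 0, matrix 1 (depth 6, 93 rows): lane FAMILIES part 12/19
# # (11 theorems, Σ lanes 43232359) at tier KERNEL — type-01 lane engine δ (`Plane.segOK` one-level segments for largest rows `< 40`;
# # per larger row a singleton + `Plane.seg2OK` second-row ranges, Census/CertBZPlaneSeg2.lean); assembled by `BZPlaneBlkZ00.lean` (qec-search-10 g3 emit_bbrow.py)
-/

set_option autoImplicit false
set_option Elab.async false

namespace Summit.Ventures.QEC.Census.A1s_n186_k10_42ba7993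

open Summit.Ventures.QEC.Census Summit.Ventures.QEC.Census.Plane

set_option maxHeartbeats 400000000 in
/-- Block 0, matrix 1: largest row 85, second-largest in `[0, 56)`, ≤ 4 below — every such selection passes (4216422 lanes; KERNEL). -/
theorem pseg2_0_1_136 : Plane.seg2OK 186 13 (A1s_n186_k10_42ba7993.cert.sideZ.found.map Prod.fst) (giRows (gbRows A1s_n186_k10_42ba7993.cert.HZ A1s_n186_k10_42ba7993.bzAutData.rcZ A1s_n186_k10_42ba7993.bzAutData.LZ A1s_n186_k10_42ba7993.bzAutBlockZ0) (A1s_n186_k10_42ba7993.bzAutBlockZ0.mats.getD 1 { T := [], A := [], t := 0 })) 6 85 0 56 4565 = true := by decide +kernel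

set_option maxHeartbeats 400000000 in
/-- Block 0, matrix 1: largest row 85, second-largest in `[56, 64)`, ≤ 4 below — every such selection passes (4087210 lanes; KERNEL). -/
theorem pseg2_0_1_137 : Plane.seg2OK 186 13 (A1s_n186_k10_42ba7993.cert.sideZ.found.map Prod.fst) (giRows (gbRows A1s_n186_k10_42ba7993.cert.HZ A1s_n186_k10_42ba7993.bzAutData.rcZ A1s_n186_k10_42ba7993.bzAutData.LZ A1s_n186_k10_42ba7993.bzAutBlockZ0) (A1s_n186_k10_42ba7993.bzAutBlockZ0.mats.getD 1 { T := [], A := [], t := 0 })) 6 85 56 8 4565 = true := by decide +kernel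

set_option maxHeartbeats 400000000 in
/-- Block 0, matrix 1: largest row 85, second-largest in `[64, 69)`, ≤ 4 below — every such selection passes (3854191 lanes; KERNEL). -/
theorem pseg2_0_1_138 : Plane.seg2OK 186 13 (A1s_n186_k10_42ba7993.cert.sideZ.found.map Prod.fst) (giRows (gbRows A1s_n186_k10_42ba7993.cert.HZ A1s_n186_k10_42ba7993.bzAutData.rcZ A1s_n186_k10_42ba7993.bzAutData.LZ A1s_n186_k10_42ba7993.bzAutBlockZ0) (A1s_n186_k10_42ba7993.bzAutBlockZ0.mats.getD 1 { T := [], A := [], t := 0 })) 6 85 64 5 4565 = true := by decide +kernel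

end Summit.Ventures.QEC.Census.A1s_n186_k10_42ba7993
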